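import Summits.AtomisticToContinuum.BoseEinsteinCondensation.Theorems.BECConjugateDominationIMUChainGlueKernelBound
import Summits.AtomisticToContinuum.BoseEinsteinCondensation.Theorems.BECConjugateDominationIMUChainGlueCoherence
import Summits.AtomisticToContinuum.BoseEinsteinCondensation.Theorems.BECConjugateDominationIMUChainGlueEnergy
import Mathlib.Analysis.SpecialFunctions.Pow.Real
import Mathlib.Data.Nat.Choose.Bounds
import HarnessLib

/-!
# Route `BECConjugateDomination` — the glue `IMUChainGlue` (stmt-AtomisticToContinuum-11790)

`PositiveMinimiser → NearMinimiserStability → ShortDistanceCoherence → PuffFloor →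
InfraredMinimumUncertainty → SmoothPeriodicBEC`, proved as stated (the route decl, by name).

Bookkeeping for a fixed smooth-class `v` (`W = ‖ṽ‖₁ < ∞`, `Energy` file):
* (i) `n₀(Ψ) = N L⁻³ ∫_cell g` for the positive minimiser (`Coherence` file);
* (ii)–(iii)–(v) the Lévy–Jensen–Parseval bound `L⁻³∫_cell g ≥ θ e^{−Err}` (`KernelBound` file:
  Parseval against the positive-definite eight-corner kernel of radius `4a`, the lattice count in
  `d = 3`, Jensen), fed with `νₘ ≤ C₁/N + (C₁√(C₂ρ)L/2πN)/|m|` from `N νₘ Sₘ ≤ C₁`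
  (`InfraredMinimumUncertainty`) and `Sₘ ≥ |k|/√(|k|² + C₂ρ)` (`PuffFloor`);
* (iv) `g ≥ 1 − |r|²T/2N ≥ ¾` within `4a = 1/√((W+1)ρ)` of the lattice, from
  `ShortDistanceCoherence`, `T ≤ E₀^per ≤ C(N,2)L⁻³W` (constant trial state) and periodicity of `g`;
* (vi) `Err = √ρ · D(v)`, so for `ρ < ρ₀ = min(ρ₁, ρ₂, 1/9(D+1)²)` and `N` large (`4a ≤ L`):
  `n₀(Ψ) ≥ N/2`, and `NearMinimiserStability` with `ε = ¼` gives `n₀ ≥ N/4` for all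
  `δ`-near-minimisers: `SmoothPeriodicBEC` with `c = ¼`.
-/

noncomputable section

open MeasureTheory Set Filter Complex
open scoped ENNReal NNReal Topology ComplexConjugate

namespace Summit.AtomisticToContinuum.BoseEinsteinCondensation.Theorems

open Literature.MathematicalPhysics.QuantumManyBody.BoseGas
open Summit.AtomisticToContinuum.BoseEinsteinCondensation.Theses.BECConjugateDomination
open Summit.AtomisticToContinuum.BoseEinsteinCondensation.Cruxes.InfraredMinimumUncertainty.FisherGaussianDensityMode
  (coherence levyWeight structureFactor waveVec norm_waveVec_pos latticeVec_one_ne_zero)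
open Summit.AtomisticToContinuum.BoseEinsteinCondensation.Theorems.IMUChainGlue

/-- The fixed profile (local notation, as in the `IMUChainGlue` helper files). -/
local notation "χ" => (ContDiffBump.normed
  (ContDiffBump.mk 1 2 one_pos one_lt_two : ContDiffBump (0 : Space)) volume)

/-- `Q₀ = ∫ χ²` (local notation). -/
local notation "Q₀" => ∫ y : Space, (χ y) ^ 2

/-- `Q₁ = ∑ⱼ ∫ |∂ⱼχ|²` (local notation). -/
local notation "Q₁" => ∑ j : Fin 3, ∫ y : Space, (fderiv ℝ χ y (EuclideanSpace.single j 1)) ^ 2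

/-! ### Small lemmas -/

/-- `L = (N/ρ)^{1/3}` is positive. -/
theorem sideLength_pos {ρ : ℝ} (hρ : 0 < ρ) (N : ℕ) (hN : 0 < N) : 0 < sideLength ρ N := by
  unfold sideLength
  exact Real.rpow_pos_of_pos (div_pos (Nat.cast_pos.2 hN) hρ) _

/-- `L³ = N/ρ`. -/
theorem sideLength_pow_three {ρ : ℝ} (hρ : 0 < ρ) (N : ℕ) (hN : 0 < N) :
    sideLength ρ N ^ 3 = (N : ℝ) / ρ := by
  have h := div_sideLength_pow_three hρ hN
  have hL := sideLength_pos hρ N hN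
  field_simp at h
  field_simp
  linarith

/-- `√(k² + c) ≤ k + √c` for `k, c ≥ 0`. -/
theorem sqrt_sq_add_le {k c : ℝ} (hk : 0 ≤ k) (hc : 0 ≤ c) : Real.sqrt (k ^ 2 + c) ≤ k + Real.sqrt c := by
  rw [Real.sqrt_le_left]
  · have := Real.sq_sqrt hc
    nlinarith [Real.sqrt_nonneg c]
  · positivity

/-- **From the two cruxes to the Lévy-weight bound of the glue**: if `N ν S ≤ C₁`,
`k/√(k² + C₂ρ) ≤ S` with `k = ‖waveVec L m‖ = (2π/L)‖m‖ > 0`, then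
`ν ≤ C₁/N + (C₁√(C₂ρ) L/(2πN)) / ‖m‖`. -/
theorem levy_bound_of_cruxes {L ρ C₁ C₂ N ν S : ℝ} (hL : 0 < L) (hρ : 0 ≤ ρ) (hC₁ : 0 ≤ C₁) (hC₂ : 0 ≤ C₂)
    (hN : 0 < N) {m : Fin 3 → ℤ} (hm : m ≠ 0) (hIMU : N * ν * S ≤ C₁)
    (hPuff : ‖waveVec L m‖ / Real.sqrt (‖waveVec L m‖ ^ 2 + C₂ * ρ) ≤ S) :
    ν ≤ C₁ / N + (C₁ * Real.sqrt (C₂ * ρ) * L / (2 * Real.pi * N)) / ‖latticeVec 1 m‖ := by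
  set k := ‖waveVec L m‖ with hk
  have hkpos : 0 < k := norm_waveVec_pos hL hm
  have hsq : 0 < Real.sqrt (k ^ 2 + C₂ * ρ) := Real.sqrt_pos.2 (by positivity)
  have hSpos : 0 < S := lt_of_lt_of_le (div_pos hkpos hsq) hPuff
  have hν : ν ≤ C₁ / (N * S) := by
    rw [le_div_iff₀ (mul_pos hN hSpos)]
    linarith
  have h1S : 1 / S ≤ Real.sqrt (k ^ 2 + C₂ * ρ) / k := by
    rw [div_le_div_iff₀ hSpos hkpos, one_mul]
    rw [div_le_iff₀ hsq] at hPuff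
    rwa [mul_comm] at hPuff
  have hkm : k = 2 * Real.pi / L * ‖latticeVec 1 m‖ := by
    rw [hk, waveVec, norm_smul, Real.norm_of_nonneg (by positivity)]
  have hlv : 0 < ‖latticeVec 1 m‖ := norm_pos_iff.2 (latticeVec_one_ne_zero hm)
  calc ν ≤ C₁ / (N * S) := hν
    _ = C₁ / N * (1 / S) := by field_simp
    _ ≤ C₁ / N * (Real.sqrt (k ^ 2 + C₂ * ρ) / k) := by gcongr
    _ ≤ C₁ / N * ((k + Real.sqrt (C₂ * ρ)) / k) := by
        gcongr
        exact sqrt_sq_add_le hkpos.le (by positivity)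
    _ = C₁ / N + (C₁ * Real.sqrt (C₂ * ρ) * L / (2 * Real.pi * N)) / ‖latticeVec 1 m‖ := by
        rw [hkm]
        field_simp

/-! ### The glue -/

/-- **`IMUChainGlue`** (stmt-AtomisticToContinuum-11790 of route `BECConjugateDomination`):
`PositiveMinimiser → NearMinimiserStability → ShortDistanceCoherence → PuffFloor →
InfraredMinimumUncertainty → SmoothPeriodicBEC`, with `c = ¼`. -/
theorem imuChainGlue_proof : IMUChainGlue := by
  intro hPM hNMS hSDC hPuff hIMU v hv₁ hv₂ hv₃ hv₄
  -- the two cruxes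
  obtain ⟨C₂, hC₂, ρ₂, hρ₂, hP⟩ := hPuff v hv₁ hv₂ hv₃ hv₄
  obtain ⟨C₁, hC₁, ρ₁, hρ₁, hI⟩ := hIMU v hv₁ hv₂ hv₃ hv₄
  -- `W = ‖ṽ‖₁ < ∞`
  obtain ⟨R₀, hR₀⟩ := hv₁.2
  have hWtop : (∫⁻ x : Space, v ‖x‖) ≠ ⊤ := (lintegral_pot_lt_top hv₂ hv₃.continuous hR₀).ne
  obtain ⟨W, hWdef⟩ : ∃ W : ℝ, W = (∫⁻ x : Space, v ‖x‖).toReal := ⟨_, rfl⟩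
  have hW0 : 0 ≤ W := by rw [hWdef]; exact ENNReal.toReal_nonneg
  -- kernel constants and the error constant
  obtain ⟨q₀, hq₀⟩ : ∃ q : ℝ, q = Q₀ := ⟨_, rfl⟩
  obtain ⟨q₁, hq₁⟩ : ∃ q : ℝ, q = Q₁ := ⟨_, rfl⟩
  have hQ₀ : 0 ≤ q₀ := by rw [hq₀]; exact integral_nonneg fun y => sq_nonneg _
  have hQ₁ : 0 ≤ q₁ := by rw [hq₁]; exact Finset.sum_nonneg fun j _ => integral_nonneg fun y => sq_nonneg _
  obtain ⟨D, hD⟩ : ∃ D : ℝ, D = 512 * q₀ * C₁ * (W + 1) * Real.sqrt (W + 1) +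
    8 / Real.pi * C₁ * Real.sqrt C₂ * (104 + 2 * q₁ / Real.pi ^ 2) * (W + 1) := ⟨_, rfl⟩
  have hD0 : 0 ≤ D := by rw [hD]; positivity
  -- the density threshold
  refine ⟨min ρ₁ (min ρ₂ (1 / (9 * (D + 1) ^ 2))), lt_min hρ₁ (lt_min hρ₂ (by positivity)), ?_⟩
  intro ρ hρ hρlt
  have hρ₁' : ρ < ρ₁ := lt_of_lt_of_le hρlt (min_le_left _ _)
  have hρ₂' : ρ < ρ₂ := lt_of_lt_of_le hρlt ((min_le_right _ _).trans (min_le_left _ _))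
  have hρD : ρ < 1 / (9 * (D + 1) ^ 2) := lt_of_lt_of_le hρlt ((min_le_right _ _).trans (min_le_right _ _))
  -- the scales: `t = √((W+1)ρ)`, kernel radius `4a = 1/t`
  obtain ⟨t, ht⟩ : ∃ t : ℝ, t = Real.sqrt ((W + 1) * ρ) := ⟨_, rfl⟩
  have htpos : 0 < t := by rw [ht]; exact Real.sqrt_pos.2 (by positivity)
  have ht2 : t ^ 2 = (W + 1) * ρ := by rw [ht]; exact Real.sq_sqrt (by positivity)
  obtain ⟨a, ha⟩ : ∃ a : ℝ, a = 1 / (4 * t) := ⟨_, rfl⟩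
  have hapos : 0 < a := by rw [ha]; positivity
  have h4a : 4 * a = 1 / t := by rw [ha]; field_simp
  -- the error is `√ρ · D ≤ 1/3`
  have hsqρ : Real.sqrt ρ * (D + 1) < 1 / 3 := by
    have h1 : Real.sqrt ρ < Real.sqrt (1 / (9 * (D + 1) ^ 2)) := Real.sqrt_lt_sqrt hρ.le hρD
    have h2 : Real.sqrt (1 / (9 * (D + 1) ^ 2)) = 1 / (3 * (D + 1)) := by
      rw [show (1 : ℝ) / (9 * (D + 1) ^ 2) = (1 / (3 * (D + 1))) ^ 2 by field_simp; norm_num,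
        Real.sqrt_sq (by positivity)]
    rw [h2] at h1
    have := mul_lt_mul_of_pos_right h1 (by positivity : 0 < D + 1)
    rwa [div_mul_eq_mul_div, one_mul, mul_comm (3 : ℝ), ← div_div, div_self (by positivity)] at this
  refine ⟨1 / 4, by norm_num, ?_⟩
  -- large `N`: the two cruxes hold and the kernel fits into the cell (`4a ≤ L ⟸ N ≥ ρ/t³`)
  have hev := (hI ρ hρ hρ₁').and ((hP ρ hρ hρ₂').and (eventually_ge_atTop ⌈ρ / t ^ 3⌉₊))
  rw [Filter.eventually_atTop] at hev ⊢
  obtain ⟨n₀, hn₀⟩ := hev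
  refine ⟨n₀ + 1, fun N hN => ?_⟩
  obtain ⟨n, rfl⟩ : ∃ n, N = n + 1 := ⟨N - 1, by omega⟩
  obtain ⟨hIn, hPn, hNn⟩ := hn₀ n (by omega)
  -- the box
  set L : ℝ := sideLength ρ (n + 1) with hLdef
  have hL : 0 < L := sideLength_pos hρ (n + 1) (Nat.succ_pos n)
  have hL3 : L ^ 3 = ((n : ℝ) + 1) / ρ := by
    rw [hLdef, sideLength_pow_three hρ (n + 1) (Nat.succ_pos n)]; push_cast; rfl
  have hNpos : (0 : ℝ) < (n : ℝ) + 1 := by positivity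
  -- `4a ≤ L`
  have h4aL : 4 * a ≤ L := by
    rw [h4a]
    have hN' : ρ / t ^ 3 ≤ (n : ℝ) + 1 := by
      have := (Nat.le_ceil (ρ / t ^ 3)).trans (by exact_mod_cast hNn : (⌈ρ / t ^ 3⌉₊ : ℝ) ≤ n)
      linarith
    have hcube : (1 / t) ^ 3 ≤ L ^ 3 := by
      rw [hL3, le_div_iff₀ hρ]
      calc (1 / t) ^ 3 * ρ = ρ / t ^ 3 := by ring
        _ ≤ (n : ℝ) + 1 := hN'
    exact le_of_pow_le_pow_left₀ (by norm_num) hL.le hcube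
  -- the positive minimiser
  obtain ⟨Ψ, hE, hfin, -, hreal, hpos⟩ := hPM v hv₁ hv₂ hv₃ hv₄ n L hL
  -- the cruxes at `Ψ`
  have hI' := hIn Ψ hE hfin hreal hpos
  have hP' := hPn Ψ hE hfin hreal hpos
  change ∀ m : Fin 3 → ℤ, m ≠ 0 → ((n : ℝ) + 1) * levyWeight n L Ψ m * structureFactor n L Ψ m ≤ C₁ at hI'
  change ∀ m : Fin 3 → ℤ, m ≠ 0 →
    ‖waveVec L m‖ / Real.sqrt (‖waveVec L m‖ ^ 2 + C₂ * ρ) ≤ structureFactor n L Ψ m at hP'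
  -- the Lévy-weight bound in the glue's form
  obtain ⟨B₁, hB₁⟩ : ∃ B : ℝ, B = C₁ / ((n : ℝ) + 1) := ⟨_, rfl⟩
  obtain ⟨B₂, hB₂⟩ : ∃ B : ℝ, B = C₁ * Real.sqrt (C₂ * ρ) * L / (2 * Real.pi * ((n : ℝ) + 1)) := ⟨_, rfl⟩
  have hB₁0 : 0 ≤ B₁ := by rw [hB₁]; positivity
  have hB₂0 : 0 ≤ B₂ := by rw [hB₂]; positivity
  -- the coherence `g`
  obtain ⟨g, hg⟩ : ∃ g : Space → ℝ, g = coherence n L Ψ := ⟨_, rfl⟩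
  have hgc : Continuous g := by rw [hg]; exact continuous_coherence Ψ
  have hgpos : ∀ r, 0 < g r := by rw [hg]; exact coherence_pos Ψ hpos
  have hν : ∀ m : Fin 3 → ℤ, m ≠ 0 →
      (cellFourierCoeff L (fun r : Space => ((Real.log (g r) : ℝ) : ℂ)) m).re ≤
        B₁ + B₂ / ‖latticeVec 1 m‖ := by
    intro m hm
    rw [hg, hB₁, hB₂]
    exact levy_bound_of_cruxes hL hρ.le hC₁ hC₂ hNpos hm (hI' m hm) (hP' m hm)
  -- step (iv): `g ≥ 3/4` within `4a` of the lattice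
  have hT := lintegral_kineticDensity_le_of_isMinimiser hL hv₁.1 Ψ hE
  have hTtop : (∫⁻ X in cellN (n + 1) L, kineticDensity Ψ.ψ X) ≠ ⊤ := by
    refine ne_top_of_le_ne_top ?_ hT
    refine ENNReal.mul_ne_top (by simp) (ENNReal.mul_ne_top (ENNReal.inv_ne_top.2 ?_) hWtop)
    exact pow_ne_zero _ (by simpa using hL)
  have hTreal : (∫⁻ X in cellN (n + 1) L, kineticDensity Ψ.ψ X).toReal ≤
      ((n : ℝ) + 1) ^ 2 / 2 * ((L ^ 3)⁻¹ * W) := by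
    have h1 := ENNReal.toReal_mono (ENNReal.mul_ne_top (by simp)
      (ENNReal.mul_ne_top (ENNReal.inv_ne_top.2 (pow_ne_zero _ (by simpa using hL))) hWtop)) hT
    rw [ENNReal.toReal_mul, ENNReal.toReal_mul, ENNReal.toReal_inv, ENNReal.toReal_pow,
      ENNReal.toReal_ofReal hL.le, ENNReal.toReal_natCast, ← hWdef] at h1
    refine h1.trans (mul_le_mul_of_nonneg_right ?_ (by positivity))
    have := Nat.choose_le_pow_div 2 (n + 1) (α := ℝ)
    simp only [Nat.factorial_two, Nat.cast_ofNat] at this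
    push_cast at this
    exact this
  have hnear : ∀ r : Space, (∃ ε ∈ (Fintype.piFinset fun _ : Fin 3 => ({0, 1} : Finset ℤ)),
      ‖r - latticeVec L ε‖ < 4 * a) → 3 / 4 ≤ g r := by
    rintro r ⟨ε, -, hε⟩
    have hper : g r = g (r - latticeVec L ε) := by
      rw [hg, ← coherence_add_latticeVec Ψ (r - latticeVec L ε) ε, sub_add_cancel]
    rw [hper]
    have hS := hSDC n L hL Ψ hTtop (r - latticeVec L ε)
    change _ ≤ coherence n L Ψ (r - latticeVec L ε) at hS
    rw [← hg] at hS
    refine le_trans ?_ hS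
    -- `‖r'‖² T/(2N) ≤ (4a)² · ((n+1)²/2 · L⁻³ W)/(2(n+1)) = (W/(W+1))/4 ≤ 1/4`
    have hr4 : ‖r - latticeVec L ε‖ ^ 2 ≤ (4 * a) ^ 2 := by
      exact pow_le_pow_left₀ (norm_nonneg _) hε.le 2
    have hkey : (4 * a) ^ 2 * (((n : ℝ) + 1) ^ 2 / 2 * ((L ^ 3)⁻¹ * W)) / (2 * ((n : ℝ) + 1)) ≤ 1 / 4 := by
      rw [h4a, hL3]
      rw [div_le_iff₀ (by positivity)]
      have hW1 : W / (W + 1) ≤ 1 := by rw [div_le_one (by positivity)]; linarith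
      have : (1 / t) ^ 2 * (((n : ℝ) + 1) ^ 2 / 2 * ((((n : ℝ) + 1) / ρ)⁻¹ * W)) =
          ((n : ℝ) + 1) / 2 * (W / (W + 1)) := by
        field_simp
        rw [ht2]
        ring
      rw [this]
      have h3 := mul_le_mul_of_nonneg_left hW1 (by positivity : (0 : ℝ) ≤ ((n : ℝ) + 1) / 2)
      linarith
    have hTn : 0 ≤ (∫⁻ X in cellN (n + 1) L, kineticDensity Ψ.ψ X).toReal := ENNReal.toReal_nonneg
    calc (3 : ℝ) / 4 = 1 - 1 / 4 := by norm_num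
      _ ≤ 1 - (4 * a) ^ 2 * (((n : ℝ) + 1) ^ 2 / 2 * ((L ^ 3)⁻¹ * W)) / (2 * ((n : ℝ) + 1)) := by linarith
      _ ≤ 1 - ‖r - latticeVec L ε‖ ^ 2 * (∫⁻ X in cellN (n + 1) L, kineticDensity Ψ.ψ X).toReal /
            (2 * ((n : ℝ) + 1)) := by
          rw [sub_le_sub_iff_left]
          exact div_le_div_of_nonneg_right (mul_le_mul hr4 hTreal hTn (sq_nonneg _)) (by positivity)
  -- steps (ii),(iii),(v): the Lévy–Jensen–Parseval bound
  have hJ := mul_exp_neg_le_setAverage hL hapos h4aL (by norm_num : (0 : ℝ) < 3 / 4) hB₁0 hB₂0 hgc hgpos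
    hnear hν
  rw [← hq₀, ← hq₁] at hJ
  -- the error is `√ρ · D ≤ 1/3`
  have hErr : B₁ * (8 * q₀ * L ^ 3 / a ^ 3) + B₂ * ((104 + 2 * q₁ / Real.pi ^ 2) * L ^ 2 / a ^ 2) ≤ 1 / 3 := by
    have hsqρ0 : 0 ≤ Real.sqrt ρ := Real.sqrt_nonneg ρ
    have htsplit : t = Real.sqrt (W + 1) * Real.sqrt ρ := by rw [ht, Real.sqrt_mul (by positivity)]
    have hT1 : B₁ * (8 * q₀ * L ^ 3 / a ^ 3) = 512 * q₀ * C₁ * (W + 1) * Real.sqrt (W + 1) * Real.sqrt ρ := by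
      have h1 : B₁ * (8 * q₀ * L ^ 3 / a ^ 3) = 512 * q₀ * C₁ * (t ^ 2 * t) / ρ := by
        rw [hB₁, ha, hL3]; field_simp; ring
      rw [h1, ht2]
      field_simp
      rw [htsplit]
      ring
    have hT2 : B₂ * ((104 + 2 * q₁ / Real.pi ^ 2) * L ^ 2 / a ^ 2) =
        8 / Real.pi * C₁ * Real.sqrt C₂ * (104 + 2 * q₁ / Real.pi ^ 2) * (W + 1) * Real.sqrt ρ := by
      have h1 : B₂ * ((104 + 2 * q₁ / Real.pi ^ 2) * L ^ 2 / a ^ 2) =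
          8 / Real.pi * C₁ * Real.sqrt (C₂ * ρ) * (104 + 2 * q₁ / Real.pi ^ 2) * t ^ 2 * L ^ 3 / ((n : ℝ) + 1) := by
        rw [hB₂, ha]; field_simp; ring
      rw [h1, ht2, hL3, Real.sqrt_mul hC₂]
      field_simp
    rw [hT1, hT2]
    have : 512 * q₀ * C₁ * (W + 1) * Real.sqrt (W + 1) * Real.sqrt ρ +
        8 / Real.pi * C₁ * Real.sqrt C₂ * (104 + 2 * q₁ / Real.pi ^ 2) * (W + 1) * Real.sqrt ρ =
        Real.sqrt ρ * D := by rw [hD]; ring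
    rw [this]
    linarith [hsqρ, hsqρ0]
  -- hence `L⁻³ ∫ g ≥ 1/2`
  have havg : 1 / 2 ≤ (L ^ 3)⁻¹ * ∫ r in cell L, g r := by
    refine le_trans ?_ hJ
    have hexp : 2 / 3 ≤ Real.exp (-(B₁ * (8 * q₀ * L ^ 3 / a ^ 3) +
        B₂ * ((104 + 2 * q₁ / Real.pi ^ 2) * L ^ 2 / a ^ 2))) := by
      have := Real.add_one_le_exp (-(B₁ * (8 * q₀ * L ^ 3 / a ^ 3) +
        B₂ * ((104 + 2 * q₁ / Real.pi ^ 2) * L ^ 2 / a ^ 2)))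
      linarith
    nlinarith
  -- step (i): `n₀(Ψ) ≥ N/2`
  have hn₀ : ENNReal.ofReal (((n : ℝ) + 1) / 2) ≤ condensateOccupation (n + 1) L Ψ.ψ := by
    rw [condensateOccupation_eq_ofReal_integral_coherence Ψ hreal, ← hg]
    refine ENNReal.ofReal_le_ofReal ?_
    have := mul_le_mul_of_nonneg_left havg hNpos.le
    linarith
  -- step (vi): stability of the condensate under `δ`-perturbations of the energy
  have hE₀top : periodicGroundStateEnergy v (n + 1) L ≠ ⊤ := hE ▸ hfin
  obtain ⟨δ, hδ, hstab⟩ := hNMS v hv₁ hv₂ hv₃ hv₄ (n + 1) L hL hE₀top (1 / 4) (by norm_num)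
  refine ⟨δ, hδ, fun Φ hΦ => ?_⟩
  have h := (hn₀.trans (hstab Ψ Φ hE hΦ))
  have hq : ENNReal.ofReal (((n : ℝ) + 1) / 2) =
      ENNReal.ofReal (1 / 4 * ((n + 1 : ℕ) : ℝ)) + ENNReal.ofReal (1 / 4 * ((n + 1 : ℕ) : ℝ)) := by
    rw [← ENNReal.ofReal_add (by positivity) (by positivity)]
    congr 1
    push_cast
    ring
  rw [hq] at h
  exact (ENNReal.add_le_add_iff_right ENNReal.ofReal_ne_top).1 h

end Summit.AtomisticToContinuum.BoseEinsteinCondensation.Theorems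

end
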